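import Summits.QuantumFields.YangMills.Theorems.UnitScaleTiltFluctuationComparisonRegPrGlobalSlackKernelLegRef
import HarnessLib

/-!
# `UnitScaleTiltFluctuationComparisonRegPrGlobalSlackKernelLegRefOwn` — THE PER-RUN REFERENCE ROWS OF 3⁗χ IN EACH RUN'S OWN INDEXING, AND THE (M6) GEOMETRY THAT CARRIES THEM
# ACROSS THE REFINEMENT (crux `FluctuationComparisonRegPrIntL`, stmt-QuantumFields-20520, skeleton v5kC, STUB 3⁗χ `stub_globalTwoRunSlackFamChi`; width seat ym-ust-20520-w1 g0, count-neutral)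

WHY.  `…KernelLegRef` (same seat) types 3⁗χ's two cross-run rows as per-run closeness rows `KernelRefΦ` / `CfgRefΦ` against run-independent reference objects; like every row
of record they carry TWO clauses, run `K`'s and run `K+1`'s, both INDEXED BY RUN `K`'s localisation domains `Y ∈ Loc K k triv (1+b)` (run `K+1`'s clause at `(b+1, refineSet Y)`,
with run `K`'s tree length and leg distances).  A v4 per-run record (NODE O) displays each run's closeness in THAT RUN'S OWN indexing.  This file proves that the own-indexed rows
give the rows of `…KernelLegRef`, the passage being pure geometry of the canonical polymerisation — slack g0's located item (M6) «`dj_{K+1}(refine Y) = dj_K(Y)`»: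

* §1 (M6) **`canonTreeLenCore_refineSet`**: `𝓛_{K+1}(k+2, refineSet Y) = 𝓛_K(k+1, Y)` for EVERY point set `Y` (`k ≤ m + K`) — the step-`k` domains of run `K` with point set `Y` and
  the step-`(k+1)` domains of run `K+1` with point set `refineSet Y` correspond under `domCast` (`refineSet_domSet`, `refineSet_injective`), with equal `dj` (`dj_domCast`);
  `chartIndex_le_of_mem_canonLocCore` (`Y ∈ Loc K k triv (1+b) ⟹ b ≤ K`).
* §2 the bond transport is a contraction (`opNorm_transport_le`, from lane A's `norm_transport_le`) and the transported weighted kernel difference is the weighted difference one run up,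
  precomposed with the transport (`kerT_sub_compLegL_eq`, matched distances) — so its norm is at most run `K+1`'s own weighted norm (`norm_kerT_sub_compLegL_le`).
* §3 the own-indexed rows **`KernelRefOwnΦ`** (run `K`'s kernels at `(b, Y)` near the reference, for ALL point sets `Y` — off the localisation domains the charts are free, take
  them equal to the reference) and **`CfgRefOwnΦ`** (run `K`'s loop variables on its own window/domains near the reference), and the transfers **`kernelRefΦ_of_own`**
  (hypotheses: matched distances, tree length non-decreasing under refinement on the domains, `0 ≤ κ, C, a`, `1 ≤ L`) and **`cfgRefΦ_of_own`** (hypotheses: `LocMatched`, matched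
  nonnegative distances, window positivity letters) — triangle-free bookkeeping: the run-`(K+1)` clause of the form-(f) row IS run `K+1`'s own clause at `(K+1, b+1, refineSet Y)`.
* §4 the geometry DISCHARGED at the χ-record's canonical polymerisation: **`kernelRefΦ_canonCore_of_own`**, **`cfgRefΦ_canonCore_of_own`** (`canonTreeLenCore_refineSet`,
  `locMatched_canonCore`, `canonLegDist_matched`, `canonLegDist_nonneg`).
HONEST FRAMING: geometry + bookkeeping over hypothesis schemas; nothing of [Balaban1985UV3] / [King1986] is asserted; registry untouched; YM₃ on T³ is a rung, not the Clay problem.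

References: C. King, CMP 102 (1986) 649–677 [King1986] (Prop. 3.6 (3.56) p.662, (3.58)–(3.61) p.663, Prop. 3.9 (3.71)–(3.72) p.665); T. Bałaban, CMP 102 (1985) 255–275
[Balaban1985UV3] ((24)–(25) p.262, (43)–(45) pp.266–267, (59) p.270); CMP 109 (1987) 249–301 [Balaban1987RG1] ((0.1) p.251).
-/

set_option autoImplicit false

noncomputable section

open scoped BigOperators
open Finset
open Literature.MathematicalPhysics.QuantumFieldTheory.Balaban1983to89
open Literature.MathematicalPhysics.QuantumFieldTheory.Balaban1983to89.T3ContinuumYM3Torus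
open Literature.MathematicalPhysics.QuantumFieldTheory.Balaban1983to89.T3UnitScaleTilt
open Literature.MathematicalPhysics.QuantumFieldTheory.Balaban1983to89.T3LevelShift
open Literature.MathematicalPhysics.QuantumFieldTheory.Balaban1983to89.T3AlphaInputsAC
open Literature.MathematicalPhysics.QuantumFieldTheory.Balaban1983to89.T3AlphaPolymerSocket
open Literature.MathematicalPhysics.QuantumFieldTheory.Balaban1983to89.T3AlphaInputsACTwoRun
open Literature.MathematicalPhysics.QuantumFieldTheory.Balaban1983to89.T3AlphaInputsACTwoRunLevel
open Literature.MathematicalPhysics.QuantumFieldTheory.Balaban1983to89.TreeLengthTorus (tsys)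
open Literature.MathematicalPhysics.QuantumFieldTheory.Balaban1985CMP102
open Literature.MathematicalPhysics.QuantumFieldTheory.Balaban1985CMP102.Setting
open Summit.QuantumFields.Balaban3D.Carriers
open Summit.QuantumFields.Balaban3D.Proofs.Primitives
open Summit.QuantumFields.Balaban3D.Proofs.GroupModelLieC (lieC)
open Summit.QuantumFields.Balaban3D.Proofs.Representation33 (jet26)
open Summit.QuantumFields.YangMills.Theorems
open Summit.QuantumFields.YangMills.Theorems.GlobalSlackKernelMatching
open Summit.QuantumFields.YangMills.Theorems.GlobalSlackCanonicalPolymers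

namespace Summit.QuantumFields.YangMills.Theorems.GlobalSlackKernelLeg

/-! ## §1 (M6) The canonical tree length and the chart index across the refinement -/

section Geometry

variable {F : T3Family} {𝔠 : AlphaConsts F.L (suGroupModel 2).N} {γ : ℝ} {hγ : 0 < γ} {hγ1 : γ ≤ (min 𝔠.gamma0 1) ^ 2}

/-- **(M6) THE CANONICAL TREE LENGTH IS MATCHED ACROSS THE REFINEMENT**: for every point set `Y` of run `K`'s fine torus and every step `k ≤ m + K`,
`canonTreeLenCore q (K+1) (k+2) (refineSet Y) = canonTreeLenCore q K (k+1) Y` — the step-`k` domains of run `K` with point set `Y` and the step-`(k+1)` domains of run `K+1`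
with point set `refineSet Y` correspond under `domCast` (same number of big blocks per direction), with the same tree length. [cite: Balaban1985UV3, (24)-(25) p.262, (59) p.270; Balaban1987RG1, (0.1) p.251] -/
theorem canonTreeLenCore_refineSet (q : ∀ K, AlphaInputsT3AC.PkgCoreV3 F 𝔠 γ hγ hγ1 K) (K k : ℕ) (hkm : k ≤ F.m + K) (Y : Set (Site (F.P K) 0)) :
    canonTreeLenCore q (K + 1) (k + 1 + 1) (refineSet F K Y) = canonTreeLenCore q K (k + 1) Y := by
  have hN := nblkOf_succ_eq (F := F) (𝔠 := 𝔠) (γ := γ) (hγ := hγ) (hγ1 := hγ1) K k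
  unfold canonTreeLenCore
  show sInf ((fun X' => (tsys 3 (nblkOf (SK F 𝔠 γ hγ hγ1 (K + 1)) 𝔠.lane.carrier (k + 1))).dj X') ''
      {X' : (tsys 3 (nblkOf (SK F 𝔠 γ hγ hγ1 (K + 1)) 𝔠.lane.carrier (k + 1))).Dom |
        domSet (F := F) 𝔠.lane.carrier.M₁ (K + 1) (k + 1) X' = refineSet F K Y}) =
    sInf ((fun X => (tsys 3 (nblkOf (SK F 𝔠 γ hγ hγ1 K) 𝔠.lane.carrier k)).dj X) ''
      {X : (tsys 3 (nblkOf (SK F 𝔠 γ hγ hγ1 K) 𝔠.lane.carrier k)).Dom | domSet (F := F) 𝔠.lane.carrier.M₁ K k X = Y})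
  congr 1
  ext t
  constructor
  · rintro ⟨X', hX', rfl⟩
    refine ⟨domCast hN.symm X', ?_, dj_domCast hN.symm X'⟩
    show domSet (F := F) 𝔠.lane.carrier.M₁ K k (domCast hN.symm X') = Y
    apply refineSet_injective K
    rw [refineSet_domSet hN _ K k hkm, domCast_domCast]
    exact hX'
  · rintro ⟨X, hX, rfl⟩
    refine ⟨domCast hN X, ?_, dj_domCast hN X⟩
    show domSet (F := F) 𝔠.lane.carrier.M₁ (K + 1) (k + 1) (domCast hN X) = refineSet F K Y
    rw [← refineSet_domSet hN _ K k hkm]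
    exact congrArg (refineSet F K) hX

/-- **A LISTED DOMAIN'S CHART INDEX IS BELOW THE RUN'S TOP**: `Y ∈ canonLocCore q K k h (1+b) ⟹ b ≤ K` (below the top the term levels are `≤ k ≤ K`; above it only the dummy level
`1`). [cite: Balaban1985UV3, (43) p.266] -/
theorem chartIndex_le_of_mem_canonLocCore (q : ∀ K, AlphaInputsT3AC.PkgCoreV3 F 𝔠 γ hγ hγ1 K) {K k b : ℕ} {h : Hist (F.P K) k} {Y : Set (Site (F.P K) 0)}
    (hY : Y ∈ canonLocCore q K k h (1 + b)) : b ≤ K := by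
  classical
  cases k with
  | zero => simp [canonLocCore] at hY
  | succ j =>
    by_cases hj : j + 1 ≤ K
    · by_cases hi : 1 + b = j + 1
      · omega
      · by_cases hi' : 1 + b ∈ Finset.Icc 1 j
        · have := (Finset.mem_Icc.mp hi').2; omega
        · simp only [canonLocCore, if_pos hj, if_neg hi, if_neg hi'] at hY
          simp at hY
    · by_cases hi1 : 1 + b = 1
      · omega
      · simp only [canonLocCore, if_neg hj, if_neg hi1] at hY
        simp at hY

/-- **(M6) AT THE χ-RECORD'S DATUM**: on the listed domains the tree length does not decrease (indeed is unchanged) under the refinement —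
`𝓛_K(1+b, Y) ≤ 𝓛_{K+1}(1+(b+1), refineSet Y)` for `Y ∈ Loc K k triv (1+b)`. [cite: Balaban1985UV3, (24)-(25) p.262, (59) p.270] -/
theorem treeLen_le_refineSet_canonCore (q : ∀ K, AlphaInputsT3AC.PkgCoreV3 F 𝔠 γ hγ hγ1 K) (K k b : ℕ) (Y : Set (Site (F.P K) 0))
    (hY : Y ∈ (AlphaInputsT3AC.dataOfCoreV3 q (canonPolymerCore q)).Loc K k ((AlphaInputsT3AC.dataOfCoreV3 q (canonPolymerCore q)).triv K k) (1 + b)) :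
    (AlphaInputsT3AC.dataOfCoreV3 q (canonPolymerCore q)).treeLen K (1 + b) Y ≤
      (AlphaInputsT3AC.dataOfCoreV3 q (canonPolymerCore q)).treeLen (K + 1) (1 + (b + 1)) (refineSet F K Y) := by
  have hb : b ≤ K := chartIndex_le_of_mem_canonLocCore q hY
  change canonTreeLenCore q K (1 + b) Y ≤ canonTreeLenCore q (K + 1) (1 + (b + 1)) (refineSet F K Y)
  rw [show 1 + b = b + 1 by ring, show 1 + (b + 1) = b + 1 + 1 by ring, canonTreeLenCore_refineSet q K b (by omega) Y]

end Geometry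

/-! ## §2 The bond transport is a contraction; transported weighted kernel differences -/

section Transport

variable {𝕍 : Type} [NormedAddCommGroup 𝕍] [NormedSpace ℂ 𝕍] {F : T3Family}

/-- The bond transport has operator norm `≤ 1` (`GlobalSlackKernelMatching.norm_transport_le`: it re-indexes along a bijection). [folklore] -/
theorem opNorm_transport_le (K b : ℕ) : ‖transport 𝕍 F K b‖ ≤ 1 :=
  ContinuousLinearMap.opNorm_le_bound _ zero_le_one fun x => by rw [one_mul]; exact norm_transport_le K b x

/-- **THE TRANSPORTED WEIGHTED DIFFERENCE IS THE WEIGHTED DIFFERENCE ONE RUN UP, PRECOMPOSED WITH THE TRANSPORT** (matched distances: `transport ∘ D_w^{(K)} = D_w^{(K+1)} ∘ transport`):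
`(kerT Φ − kerT Ψ)_{K,b,Y} ∘ D_w^{(K)} = ((ker Φ − ker Ψ)_{K+1,b+1,refineSet Y} ∘ D_w^{(K+1)}) ∘ transport`. [cite: King1986, Prop. 3.6 (3.56) p.662; Balaban1987RG1, (0.1) p.251] -/
theorem kerT_sub_compLegL_eq {dist : LegDist F} (hm : DistMatched dist) (κ' : ℝ) (Φ Ψ : ChartFam 𝕍 F) (K b : ℕ) (Y : Set (Site (F.P K) 0)) (d : ℕ) :
    (kerT Φ K b Y d - kerT Ψ K b Y d).compContinuousLinearMap (fun _ => legL 𝕍 dist κ' K b Y) =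
      (((ker Φ (K + 1) (b + 1) (refineSet F K Y) d - ker Ψ (K + 1) (b + 1) (refineSet F K Y) d).compContinuousLinearMap
          fun _ => legL 𝕍 dist κ' (K + 1) (b + 1) (refineSet F K Y)).compContinuousLinearMap fun _ => transport 𝕍 F K b) := by
  ext v
  simp only [ContinuousMultilinearMap.compContinuousLinearMap_apply, sub_apply, kerT, legL_apply]
  have hv : (fun i => transport 𝕍 F K b (legD 𝕍 dist κ' K b Y (v i))) =
      fun i => legD 𝕍 dist κ' (K + 1) (b + 1) (refineSet F K Y) (transport 𝕍 F K b (v i)) := by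
    funext i
    exact transport_legD hm κ' K b Y (v i)
  rw [hv]

/-- **THE TRANSPORTED WEIGHTED DIFFERENCE IS BOUNDED BY RUN `K+1`'S OWN WEIGHTED DIFFERENCE** (matched distances; the transport is a contraction).
[cite: King1986, Prop. 3.6 (3.56) p.662] -/
theorem norm_kerT_sub_compLegL_le {dist : LegDist F} (hm : DistMatched dist) (κ' : ℝ) (Φ Ψ : ChartFam 𝕍 F) (K b : ℕ) (Y : Set (Site (F.P K) 0)) (d : ℕ) :
    ‖(kerT Φ K b Y d - kerT Ψ K b Y d).compContinuousLinearMap (fun _ => legL 𝕍 dist κ' K b Y)‖ ≤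
      ‖(ker Φ (K + 1) (b + 1) (refineSet F K Y) d - ker Ψ (K + 1) (b + 1) (refineSet F K Y) d).compContinuousLinearMap
          fun _ => legL 𝕍 dist κ' (K + 1) (b + 1) (refineSet F K Y)‖ := by
  rw [kerT_sub_compLegL_eq hm]
  refine (ContinuousMultilinearMap.norm_compContinuousLinearMap_le _ _).trans ?_
  have hprod : ∏ _i : Fin d, ‖transport 𝕍 F K b‖ ≤ 1 :=
    Finset.prod_le_one (fun _ _ => norm_nonneg _) fun _ _ => opNorm_transport_le K b
  calc _ ≤ ‖(ker Φ (K + 1) (b + 1) (refineSet F K Y) d - ker Ψ (K + 1) (b + 1) (refineSet F K Y) d).compContinuousLinearMap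
          fun _ => legL 𝕍 dist κ' (K + 1) (b + 1) (refineSet F K Y)‖ * 1 := mul_le_mul_of_nonneg_left hprod (norm_nonneg _)
    _ = _ := mul_one _

end Transport

/-! ## §3 The own-indexed per-run rows and the transfers -/

section Own

variable {𝕍 : Type} [NormedAddCommGroup 𝕍] [NormedSpace ℂ 𝕍] {F : T3Family} {γ : ℝ}

/-- **THE OWN-INDEXED PER-RUN KERNEL CLOSENESS ROW** (hypothesis schema, never asserted): for EVERY run `K`, chart index `b`, point set `Y` and order `2 ≤ d ≤ 6`, run `K`'s weighted
order-`d` flat kernel at `(b, Y)` is within `C·e^{−κ𝓛_K(1+b, Y)}·(L^{−(1+b)})^a` of the reference family's — ONE run, its own lattices, its own tree length (off the localisation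
domains the charts are unconstrained by the other rows; take them equal to the reference there). [cite: King1986, Prop. 3.6 (3.56) p.662, (3.58)-(3.61) p.663] -/
def KernelRefOwnΦ (D : AlphaDataT3 F γ) (Φ Ψ : ChartFam 𝕍 F) (dist : LegDist F) (κ' κ a C : ℝ) : Prop :=
  ∀ (K b : ℕ) (Y : Set (Site (F.P K) 0)), ∀ d ∈ Finset.Ico 2 7,
    ‖(ker Φ K b Y d - ker Ψ K b Y d).compContinuousLinearMap fun _ => legL 𝕍 dist κ' K b Y‖ ≤
      C * Real.exp (-κ * D.treeLen K (1 + b) Y) * (((F.L : ℝ) ^ (1 + b))⁻¹) ^ a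

/-- **TREE LENGTH DOES NOT DECREASE UNDER THE REFINEMENT ON THE LISTED DOMAINS** (hypothesis schema on the polymer parameter; a THEOREM for the canonical polymerisation,
`treeLen_le_refineSet_canonCore`). [cite: Balaban1985UV3, (24)-(25) p.262] -/
def TreeLenRefinedOn (D : AlphaDataT3 F γ) : Prop :=
  ∀ (K k b : ℕ) (Y : Set (Site (F.P K) 0)), Y ∈ D.Loc K k (D.triv K k) (1 + b) → D.treeLen K (1 + b) Y ≤ D.treeLen (K + 1) (1 + (b + 1)) (refineSet F K Y)

/-- **THE OWN-INDEXED KERNEL ROW GIVES THE FORM OF RECORD**: `KernelRefOwnΦ … C → KernelRefΦ … C` (matched distances, tree length non-decreasing under refinement on the domains,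
`0 ≤ κ`, `0 ≤ C`, `0 ≤ a`, `1 ≤ L`): run `K+1`'s clause at `(b+1, refineSet Y)` is its OWN clause there, transported by a contraction, with `𝓛_{K+1} ≥ 𝓛_K` and
`(L^{−(2+b)})^a ≤ (L^{−(1+b)})^a`. [cite: King1986, Prop. 3.6 (3.56) p.662] -/
theorem kernelRefΦ_of_own {D : AlphaDataT3 F γ} {Φ Ψ : ChartFam 𝕍 F} {dist : LegDist F} {κ' κ a C : ℝ}
    (hm : DistMatched dist) (hT : TreeLenRefinedOn D) (hκ : 0 ≤ κ) (hC : 0 ≤ C) (ha : 0 ≤ a) (hL : 1 ≤ F.L)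
    (h : KernelRefOwnΦ D Φ Ψ dist κ' κ a C) : KernelRefΦ D Φ Ψ dist κ' κ a C := by
  intro K k b Y hY d hd
  refine ⟨h K b Y d hd, (norm_kerT_sub_compLegL_le hm κ' Φ Ψ K b Y d).trans ((h (K + 1) (b + 1) (refineSet F K Y) d hd).trans ?_)⟩
  have hL0 : (0 : ℝ) < F.L := by exact_mod_cast (show 0 < F.L by omega)
  have hLr : (1 : ℝ) ≤ F.L := by exact_mod_cast hL
  have hexp : Real.exp (-κ * D.treeLen (K + 1) (1 + (b + 1)) (refineSet F K Y)) ≤ Real.exp (-κ * D.treeLen K (1 + b) Y) :=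
    Real.exp_le_exp.mpr (by nlinarith [hT K k b Y hY])
  have hrate : (((F.L : ℝ) ^ (1 + (b + 1)))⁻¹) ^ a ≤ (((F.L : ℝ) ^ (1 + b))⁻¹) ^ a :=
    Real.rpow_le_rpow (by positivity) (inv_anti₀ (by positivity) (pow_le_pow_right₀ hLr (by omega))) ha
  have h1 : 0 ≤ C * Real.exp (-κ * D.treeLen (K + 1) (1 + (b + 1)) (refineSet F K Y)) := mul_nonneg hC (Real.exp_pos _).le
  calc C * Real.exp (-κ * D.treeLen (K + 1) (1 + (b + 1)) (refineSet F K Y)) * (((F.L : ℝ) ^ (1 + (b + 1)))⁻¹) ^ a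
      ≤ C * Real.exp (-κ * D.treeLen (K + 1) (1 + (b + 1)) (refineSet F K Y)) * (((F.L : ℝ) ^ (1 + b))⁻¹) ^ a := mul_le_mul_of_nonneg_left hrate h1
    _ ≤ C * Real.exp (-κ * D.treeLen K (1 + b) Y) * (((F.L : ℝ) ^ (1 + b))⁻¹) ^ a :=
        mul_le_mul_of_nonneg_right (mul_le_mul_of_nonneg_left hexp hC) (Real.rpow_nonneg (by positivity) _)

/-- **THE OWN-INDEXED PER-RUN LOOP-VARIABLE CLOSENESS ROW** (hypothesis schema, never asserted; distance form, window profile `p₀`): on run `K`'s `θ(n)`-window and run `K`'s own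
listed domains `Y ∈ Loc K (K−n) triv (1+j)`, leg by leg, run `K`'s loop variable is within `C_B·(1 + d(c))·θ(n)·x²·(L^{−(1+j)})^a` of the reference functional — ONE run only.
[cite: King1986, Prop. 3.9 (3.71)-(3.72) p.665; Balaban1985UV3, (44) p.267] -/
def CfgRefOwnΦ (D : AlphaDataT3 F γ) (B BR : CfgFam 𝕍 F) (dist : LegDist F) (b₀ p₀ a C_B : ℝ) : Prop :=
  ∀ (K n : ℕ) (h : n ≤ K), ∀ j : ℕ, j < K - n →
    ∀ V : GaugeField (F.P n) 0 (Matrix.specialUnitaryGroup (Fin 2) ℂ), PlaqSmall (θBal F.L γ b₀ p₀ n) V →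
      ∀ Y ∈ D.Loc K (K - n) (D.triv K (K - n)) (1 + j), ∀ c : PBond (F.P K) j,
        ‖B K (K - n) j Y (fieldShift (F.sitesPerDir_eq (m := F.m) (K := K) (j := K - n) (m' := F.m) (K' := n) (j' := 0) (by omega)) V) c -
            BR K (K - n) j Y (fieldShift (F.sitesPerDir_eq (m := F.m) (K := K) (j := K - n) (m' := F.m) (K' := n) (j' := 0) (by omega)) V) c‖ ≤
          C_B * (1 + dist K j Y c) * θBal F.L γ b₀ p₀ n * (((F.L : ℝ) ^ (K - n - 1 - j))⁻¹) ^ 2 * (((F.L : ℝ) ^ (1 + j))⁻¹) ^ a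

omit [NormedSpace ℂ 𝕍] in
/-- **THE OWN-INDEXED LOOP-VARIABLE ROW GIVES THE FORM OF RECORD**: `CfgRefOwnΦ … C_B → CfgRefΦ … C_B` (`LocMatched`: run `K`'s level-`(1+j)` domains at height `n` refine to run
`K+1`'s level-`(2+j)` domains at the same height; matched nonnegative distances; the window letters `1 ≤ L`, `0 < γ ≤ 1`, `0 < b₀` for `θ ≥ 0`; `0 ≤ C_B`, `0 ≤ a`).
[cite: King1986, Prop. 3.9 (3.71)-(3.72) p.665] -/
theorem cfgRefΦ_of_own {D : AlphaDataT3 F γ} {B BR : CfgFam 𝕍 F} {dist : LegDist F} {b₀ p₀ a C_B : ℝ}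
    (hLoc : LocMatched D) (hm : DistMatched dist) (hn : DistNonneg dist) (hL : 1 ≤ F.L) (hγ : 0 < γ) (hγ1 : γ ≤ 1) (hb : 0 < b₀) (hCB : 0 ≤ C_B) (ha : 0 ≤ a)
    (h : CfgRefOwnΦ D B BR dist b₀ p₀ a C_B) : CfgRefΦ D B BR dist b₀ p₀ a C_B := by
  intro K n hnK j hj V hV Y hY c
  refine ⟨h K n hnK j hj V hV Y hY c, ?_⟩
  -- run `K+1`'s own clause at height `n`, level `j + 1`, domain `refineSet Y`, bond `matchBond c`
  have hY' : refineSet F K Y ∈ D.Loc (K + 1) (K + 1 - n) (D.triv (K + 1) (K + 1 - n)) (1 + (j + 1)) := by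
    have hmaps := (hLoc K n hnK (1 + j) (by omega) (by omega)).mapsTo (Finset.mem_coe.mpr hY)
    rw [show 1 + (j + 1) = 1 + j + 1 by ring]
    exact Finset.mem_coe.mp hmaps
  have hown := h (K + 1) n (by omega) (j + 1) (by omega) V hV (refineSet F K Y) hY' (matchBond F K j c)
  have hθ : 0 ≤ θBal F.L γ b₀ p₀ n := (T3MinimiserStabilityReduction.θBal_pos hL hγ hγ1 hb p₀ n).le
  have hLr : (1 : ℝ) ≤ F.L := by exact_mod_cast hL
  have hd : 0 ≤ 1 + dist K j Y c := by linarith [hn K j Y c]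
  have hrate : (((F.L : ℝ) ^ (1 + (j + 1)))⁻¹) ^ a ≤ (((F.L : ℝ) ^ (1 + j))⁻¹) ^ a :=
    Real.rpow_le_rpow (by positivity) (inv_anti₀ (by positivity) (pow_le_pow_right₀ hLr (by omega))) ha
  rw [hm K j Y c, show K + 1 - n - 1 - (j + 1) = K - n - 1 - j by omega] at hown
  refine hown.trans ?_
  have h0 : 0 ≤ C_B * (1 + dist K j Y c) * θBal F.L γ b₀ p₀ n * (((F.L : ℝ) ^ (K - n - 1 - j))⁻¹) ^ 2 := by positivity
  exact mul_le_mul_of_nonneg_left hrate h0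

end Own

/-! ## §4 The geometry discharged at the χ-record's canonical polymerisation -/

section Canon

variable {F : T3Family} {𝔠 : AlphaConsts F.L (suGroupModel 2).N} {γ : ℝ} {hγ : 0 < γ} {hγ1 : γ ≤ (min 𝔠.gamma0 1) ^ 2}

/-- `TreeLenRefinedOn` HOLDS for the canonical polymerisation of every family of data cores (`treeLen_le_refineSet_canonCore`). [cite: Balaban1985UV3, (24)-(25) p.262] -/
theorem treeLenRefinedOn_canonCore (q : ∀ K, AlphaInputsT3AC.PkgCoreV3 F 𝔠 γ hγ hγ1 K) : TreeLenRefinedOn (AlphaInputsT3AC.dataOfCoreV3 q (canonPolymerCore q)) :=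
  fun K k b Y hY => treeLen_le_refineSet_canonCore q K k b Y hY

/-- **THE OWN-INDEXED KERNEL ROW GIVES `KernelRefΦ` AT THE χ-RECORD'S CANONICAL POLYMERISATION** (canonical leg distance; decay `κ ≥ 0`, e.g. `𝔠.κ`; `0 ≤ C`, `0 ≤ a`) — no
hypothesis left but the row. [cite: King1986, Prop. 3.6 (3.56) p.662; Balaban1985UV3, (24)-(25) p.262] -/
theorem kernelRefΦ_canonCore_of_own (p : ∀ K, AlphaInputsT3AC.PkgAtV3Chi F 𝔠 γ hγ hγ1 K) {Φ Ψ : ChartFam ↥(lieC (suGroupModel 2)) F} {κ' κ a C : ℝ}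
    (hκ : 0 ≤ κ) (hC : 0 ≤ C) (ha : 0 ≤ a)
    (h : KernelRefOwnΦ (AlphaInputsT3AC.dataOfV3chi p (canonPolymerCore fun K => (p K).toCore)) Φ Ψ (canonLegDist F) κ' κ a C) :
    KernelRefΦ (AlphaInputsT3AC.dataOfV3chi p (canonPolymerCore fun K => (p K).toCore)) Φ Ψ (canonLegDist F) κ' κ a C :=
  kernelRefΦ_of_own (canonLegDist_matched F) (treeLenRefinedOn_canonCore fun K => (p K).toCore) hκ hC ha F.hL.2.le h

/-- **THE OWN-INDEXED LOOP-VARIABLE ROW GIVES `CfgRefΦ` AT THE χ-RECORD'S CANONICAL POLYMERISATION** (canonical leg distance; `LocMatched` = `locMatched_canonCore`; window letters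
from the record: `𝔠.b₀ > 0`, `γ ≤ (min γ₀ 1)² ≤ 1`). [cite: King1986, Prop. 3.9 (3.71)-(3.72) p.665; Balaban1987RG1, (0.1) p.251] -/
theorem cfgRefΦ_canonCore_of_own (p : ∀ K, AlphaInputsT3AC.PkgAtV3Chi F 𝔠 γ hγ hγ1 K) {B BR : CfgFam ↥(lieC (suGroupModel 2)) F} {a C_B : ℝ}
    (hCB : 0 ≤ C_B) (ha : 0 ≤ a)
    (h : CfgRefOwnΦ (AlphaInputsT3AC.dataOfV3chi p (canonPolymerCore fun K => (p K).toCore)) B BR (canonLegDist F) 𝔠.b₀ 𝔠.p₀ a C_B) :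
    CfgRefΦ (AlphaInputsT3AC.dataOfV3chi p (canonPolymerCore fun K => (p K).toCore)) B BR (canonLegDist F) 𝔠.b₀ 𝔠.p₀ a C_B :=
  cfgRefΦ_of_own (locMatched_canonCore fun K => (p K).toCore) (canonLegDist_matched F) (canonLegDist_nonneg F) F.hL.2.le hγ
    (hγ1.trans (sq_min_one_le _ 𝔠.gamma0_pos)) 𝔠.b₀_pos hCB ha h

end Canon

end Summit.QuantumFields.YangMills.Theorems.GlobalSlackKernelLeg

end
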